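import Mathlib
import HarnessLib.Audit
import Summits.PneNP.PneNP.Theorems.PstarGapTwo

/-!
# The core/pendant split of the two-query rung (ROUND-24, GAPTWO-PLAN S4 statement; planner seat p3 g20)

FRONTIER range-avoidance ladder, rung F-N3, ROUND 24 (cell `pnp-ideate`; restricted-model proof complexity — nothing here bears on
`P` versus `NP`).

`PstarGapTwo.GapTwo` (`|W| ≤ 2 ⇒ |J| ≤ K(Δ)` for minimal `W`-infeasible output sets `J` of expanding typed pure-`P⋆` instances with
simple overlaps and variable degree `≤ Δ`) has been reduced by the cell (GAPTWO-PLAN S1–S3: `PstarGapTwoTerminal.terminal_form`,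
`PstarGapTwoDichotomy.small_or_chordal_core`, `PstarFreeFoldedForms` / `PstarFreeFolded.card_folded_le`, `PstarGSystemGraphGap`) to a bound
on the CORE: after folding every output with a private XOR slot into the (at most two) constraints, what is left is an XOR-CLOSED set
`J₀ ⊆ J` — no output of `J₀` has an XOR slot on the boundary of `J₀` (terminal condition (T1)) — and everything outside the core is
controlled by `6Δ² + 4Δ·|J₀|`.  This file types the two halves as named statements and records the (trivial) logical relations:

* `XorClosed I J₀` — the terminal condition (T1) verbatim; XOR-closed sets are closed under union (`xorClosed_union`), so the largest
  XOR-closed subset of `J` (the 2-core of the XOR multigraph of `J`) contains every terminal core.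
* `CoreBound` (S4, OPEN): every XOR-closed `J₀ ⊆ J` of a minimal infeasible `(J, W)` with `|W| ≤ 2` has `|J₀| ≤ K₀(Δ)`.
* `PendantBound` (S3 with a core; being proved by the cell): some XOR-closed `J₀ ⊆ J` has `|J| ≤ K₁(Δ)·(|J₀| + 1)`.
* `gapTwo_iff : GapTwo ↔ CoreBound ∧ PendantBound` (both directions are bookkeeping; the content is in the two conjuncts).

What is known about `K₀` (memo `HOME/pnp-ideate-p3/r24/CORE-BOUND-NOTES.md`): every core found so far (kit censuses K10/K11, the
hand analysis of NOR-forced cores) has at most `5` outputs — two XOR-triangles sharing an edge, forced by a NOR reading `a₀ = a₁ = 0` of one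
constraint and read by the other; hereditary `3/2`-boundary expansion forbids hanging a second forced component on the same literal pair
(a reader-free core family with `B` literal-edges and `C` chords has at most `B + 2C (+2)` boundary variables, so it needs `C ≥ B - O(1)`,
while a forced component offers `C < B`).  Whether `K₀` can be taken INDEPENDENT of `Δ` is open (kit K12).  The reader cluster shows the
pendant constant is `Θ(Δ²)`, so `K(Δ) = Θ(Δ²)` overall in any case.
-/

set_option linter.dupNamespace false

open Finset Literature.Computability.Complexity
open Summit.PneNP.PneNP.Theorems.PstarTyped (Typed)
open Summit.PneNP.PneNP.Theorems.PstarSALevel (varSet bdry BoundaryExpanding SimpleOverlap)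
open Summit.PneNP.PneNP.Theorems.PstarGapLemma (MinInfeasible MaxDegree)
open Summit.PneNP.PneNP.Theorems.PstarGapTwo (GapTwo)

namespace Summit.PneNP.PneNP.Theorems.PstarCoreBound

variable {n m : ℕ}

/-- `J₀` is XOR-CLOSED: no output of `J₀` has an XOR slot (slots `0,1` of `xorAndPred`) on the boundary of `J₀`; equivalently every
XOR variable of `J₀` is read by at least two outputs of `J₀` (the terminal condition (T1) of `PstarGapTwoTerminal.terminal_form`). -/
def XorClosed (I : LocalMap 4 n m) (J₀ : Finset (Fin m)) : Prop :=
  ∀ f ∈ J₀, ∀ s : Fin 4, s.val < 2 → I.vars f s ∉ bdry I J₀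

/-- **GAPTWO-PLAN S4 — the core bound (OPEN).**  On expanding typed pure-`P⋆` instances with simple overlaps and variable degree `≤ Δ`:
every XOR-closed subset `J₀` of a minimal infeasible output set `J` under at most two parity constraints has at most `K₀(Δ)` outputs.
(All known cores have `≤ 5` outputs; `K₀` independent of `Δ` is not excluded.)  FRONTIER. -/
@[conjecture] def CoreBound : Prop :=
  ∀ Δ : ℕ, ∃ K₀ : ℕ, ∀ (n m r : ℕ) (I : LocalMap 4 n m), I.IsPure xorAndPred → Typed I → BoundaryExpanding r I →
    SimpleOverlap I → MaxDegree Δ I → ∀ (y : Fin m → Bool) (W : Finset (Finset (Fin n) × Bool)) (J : Finset (Fin m)),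
      W.card ≤ 2 → J.card ≤ r → MinInfeasible I y W J →
        ∀ J₀ : Finset (Fin m), J₀ ⊆ J → XorClosed I J₀ → J₀.card ≤ K₀

/-- **GAPTWO-PLAN S3 with a core — the pendant bound (being proved by the cell: `terminal_form` + `card_folded_le`).**  Some XOR-closed
`J₀ ⊆ J` (the terminal core) controls the rest: `|J| ≤ K₁(Δ)·(|J₀| + 1)`.  FRONTIER. -/
@[conjecture] def PendantBound : Prop :=
  ∀ Δ : ℕ, ∃ K₁ : ℕ, ∀ (n m r : ℕ) (I : LocalMap 4 n m), I.IsPure xorAndPred → Typed I → BoundaryExpanding r I →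
    SimpleOverlap I → MaxDegree Δ I → ∀ (y : Fin m → Bool) (W : Finset (Finset (Fin n) × Bool)) (J : Finset (Fin m)),
      W.card ≤ 2 → J.card ≤ r → MinInfeasible I y W J →
        ∃ J₀ : Finset (Fin m), J₀ ⊆ J ∧ XorClosed I J₀ ∧ J.card ≤ K₁ * (J₀.card + 1)

/-- The empty set is XOR-closed. -/
theorem xorClosed_empty (I : LocalMap 4 n m) : XorClosed I ∅ := by
  intro f hf
  simp at hf

/-- XOR-closed sets are closed under union (so the union of all XOR-closed subsets of `J` — the 2-core of the XOR multigraph — is the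
largest one, and it contains every terminal core). -/
theorem xorClosed_union (I : LocalMap 4 n m) {J₀ J₁ : Finset (Fin m)} (h₀ : XorClosed I J₀) (h₁ : XorClosed I J₁) :
    XorClosed I (J₀ ∪ J₁) := by
  classical
  -- one inclusion argument, used for both halves
  have key : ∀ {A B : Finset (Fin m)}, XorClosed I A → A ⊆ B →
      ∀ f ∈ A, ∀ s : Fin 4, s.val < 2 → I.vars f s ∉ bdry I B := by
    intro A B hA hAB f hf s hs hmem
    apply hA f hf s hs
    -- `v := I.vars f s` is read by exactly one output of `B`; the outputs of `A` reading it form a subset containing `f`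
    have hv : f ∈ A.filter (fun j => I.vars f s ∈ varSet I j) := by
      simp only [Finset.mem_filter, varSet, Finset.mem_image, Finset.mem_univ, true_and]
      exact ⟨hf, s, rfl⟩
    have hB1 : (B.filter (fun j => I.vars f s ∈ varSet I j)).card = 1 := by
      simpa [bdry] using hmem
    have hsub : A.filter (fun j => I.vars f s ∈ varSet I j) ⊆ B.filter (fun j => I.vars f s ∈ varSet I j) :=
      Finset.filter_subset_filter _ hAB
    have hle : (A.filter (fun j => I.vars f s ∈ varSet I j)).card ≤ 1 := hB1 ▸ Finset.card_le_card hsub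
    have hpos : 0 < (A.filter (fun j => I.vars f s ∈ varSet I j)).card := Finset.card_pos.mpr ⟨f, hv⟩
    have hA1 : (A.filter (fun j => I.vars f s ∈ varSet I j)).card = 1 := by omega
    simpa [bdry] using hA1
  intro f hf s hs
  rcases Finset.mem_union.mp hf with hf₀ | hf₁
  · exact key h₀ Finset.subset_union_left f hf₀ s hs
  · exact key h₁ Finset.subset_union_right f hf₁ s hs

/-- `GapTwo ⇒ CoreBound` (a subset is no larger than the set). -/
theorem coreBound_of_gapTwo (h : GapTwo) : CoreBound := by
  intro Δ
  obtain ⟨K, hK⟩ := h Δ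
  refine ⟨K, fun n m r I hI hT hB hS hD y W J hW hJ hmin J₀ hsub _ => ?_⟩
  exact (Finset.card_le_card hsub).trans (hK n m r I hI hT hB hS hD y W J hW hJ hmin)

/-- `GapTwo ⇒ PendantBound` (take `J₀ = ∅`). -/
theorem pendantBound_of_gapTwo (h : GapTwo) : PendantBound := by
  intro Δ
  obtain ⟨K, hK⟩ := h Δ
  refine ⟨K, fun n m r I hI hT hB hS hD y W J hW hJ hmin => ⟨∅, Finset.empty_subset _, xorClosed_empty I, ?_⟩⟩
  simpa using hK n m r I hI hT hB hS hD y W J hW hJ hmin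

/-- **The assembly shape: `CoreBound ∧ PendantBound ⇒ GapTwo`** with `K(Δ) = K₁(Δ)·(K₀(Δ) + 1)`. -/
theorem gapTwo_of_coreBound_of_pendantBound (hc : CoreBound) (hp : PendantBound) : GapTwo := by
  intro Δ
  obtain ⟨K₀, hK₀⟩ := hc Δ
  obtain ⟨K₁, hK₁⟩ := hp Δ
  refine ⟨K₁ * (K₀ + 1), fun n m r I hI hT hB hS hD y W J hW hJ hmin => ?_⟩
  obtain ⟨J₀, hsub, hx, hcard⟩ := hK₁ n m r I hI hT hB hS hD y W J hW hJ hmin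
  have h0 : J₀.card ≤ K₀ := hK₀ n m r I hI hT hB hS hD y W J hW hJ hmin J₀ hsub hx
  calc J.card ≤ K₁ * (J₀.card + 1) := hcard
    _ ≤ K₁ * (K₀ + 1) := Nat.mul_le_mul_left K₁ (by omega)

/-- The two-query rung is exactly the conjunction of the core bound and the pendant bound. -/
theorem gapTwo_iff : GapTwo ↔ CoreBound ∧ PendantBound :=
  ⟨fun h => ⟨coreBound_of_gapTwo h, pendantBound_of_gapTwo h⟩, fun h => gapTwo_of_coreBound_of_pendantBound h.1 h.2⟩

end Summit.PneNP.PneNP.Theorems.PstarCoreBound
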